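import Literature.MathematicalPhysics.QuantumManyBody.LiebSimpleEquationFacts
import Mathlib.Analysis.SpecialFunctions.Pow.Integral
import Mathlib.Analysis.Calculus.Deriv.MeanValue
import HarnessLib

/-!
# Lieb's simple equation: CJL-II Theorem 3 as printed is inconsistent with CJL-I Theorems 1–2

Topic: `Literature/MathematicalPhysics/QuantumManyBody`. CJL-II = Carlen–Jauslin–Lieb, SIAM J. Math.
Anal. 53 (2021), arXiv:2010.13882; CJL-I = Pure Appl. Anal. 2 (2020), arXiv:1912.04987; numbering
of the arXiv versions (Theorem 3 of arXiv = Theorem 1.3 of the journal). **CJL-II Theorem 3 as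
printed** reads: "Assume that `(1 + |x|⁴)v ∈ L¹(ℝ³) ∩ L²(ℝ³)`. For `e < e⋆ := √2π³/‖v‖₁²` and for
`e > 2³‖v‖₂⁴/π⁴`, `ρ(e)` is strictly monotone increasing in `e`, and in these intervals `ρ(e)` is
continuously differentiable. […] Moreover, for `e < e⋆` we have `ρ′ = dρ/de ≤ 16/‖v‖₁`." This file
proves that this statement — rendered with `ρ(·) = densityFn v`, `e⋆ = eStar v`,
`2³‖v‖₂⁴/π⁴ = eHigh v` of `LiebSimpleEquationFacts.lean`, `e > 0`, `v ≢ 0` — is inconsistent with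
CJL-I Theorems 1–2 (the named facts `CarlenJauslinLieb2020_thm1`, `CarlenJauslinLieb2020_thm2`),
which is why CJL-II Theorem 3 is NOT vendored as a named fact: the refuting theorems below carry the
printed statement verbatim in their types instead (`not_CarlenJauslinLieb2021_thm3`).

## The defect in print

The proof of CJL-II Theorem 3 (CJL-II §3) uses three times the bound "`ρ ≤ 4e/‖v‖₁` by (1.21) of
[CJL20]" ((con4B) there), i.e. the upper half of the display `2e/‖𝒱‖₁ ≤ ρ(e) ≤ 4e/‖𝒱‖₁` of CJL-I
§1 (quoted again in CJL-II §1): to turn `2ρ‖𝔎_e v‖₂‖u‖₂ ≤ c‖v‖₁²e^{-1/2}·ρ` into a bound in `e`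
alone (whence the window `e < e⋆`), in the step `ρ′ ≤ 4ρ/e ≤ 16/‖v‖₁`, and in
`ρ‖u‖₂ ≤ (4e/‖v‖₁)(‖v‖₂/2e)` (whence the window `e > 2³‖v‖₂⁴/π⁴`). That upper half does not
follow from the display preceding it in CJL-I §1 (`ρ ≤ (∫K_e𝒱)⁻¹ = 4e/∫𝒱(1 − K_e𝒱)`, which is
`≥ 4e/‖𝒱‖₁`, not `≤`), and it is false at low energy for strong potentials: by CJL-I Theorem 2,
`ρ(e)/e → 1/(2πa)` as `e → 0⁺`, so `ρ(e) ≤ 4e/‖v‖₁` near `0` would force `‖v‖₁ ≤ 8πa`, i.e. a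
scattering length at least half its Born value `‖v‖₁/(4π)`. (Secondary slip: the display "In
particular `‖u‖₂ ≤ ‖v‖₁e^{-1/4}/(4√π)`" after CJL-II Lemma 1 halves the constant
`C₂ = ‖v‖₁/(2√π)` of that lemma; `e⋆` is computed from the halved constant.) CJL-II Lemma 16
(`e ↦ eρ(e)` strictly increasing), the formula (rpratio) for `ρ′` and the differentiability
argument of §3 do not use (1.21); after removing the false bound the printed argument supports only
the QUALITATIVE statement "`ρ` is strictly increasing and `C¹` on some `(0,e₀(v))` and on some
`(e₁(v),∞)`, with `ρ′ ≤ 4ρ/e` on the former" (thresholds depending on `v` through `ρ(·)`), which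
is printed nowhere with a proof (Jauslin's 2022 review, Thm 4.2, repeats the printed thresholds)
and is therefore not vendored either.

## What is proved here

* `IsScatteringSolution.integral_mul_one_sub_le` — for `0 ≤ v ≤ V₀` vanishing off `|x| < R` and
  any scattering solution `φ` (`0 ≤ φ ≤ 1`, `φ = Y_0 ∗ (v(1 − φ))`) with `v(1 − φ)` integrable:
  `∫v(1 − φ) ≤ 4πR`, i.e. `a ≤ R` (evaluate the equation at the origin, `Y_0 ≥ (4πR)⁻¹` on the
  support, `φ(0) ≤ 1`).
* `exists_isWeightedPotential_scatteringLength_lt` — the square well `v = 30·𝟙_{|x|<1}` is a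
  CJL-II potential (`IsWeightedPotential`, `∫v = 40π > 0`) with `32π·a < ∫v` for every scattering
  solution.
* `densityFn_le_mul_of_deriv_le` — `ρ ∈ C(0,∞)`, `ρ(0⁺) = 0`, `ρ′ ≤ C` on `(0,E)` give
  `ρ(e) ≤ Ce` on `(0,E)` (mean value inequality).
* `not_CarlenJauslinLieb2021_thm3_of_potential` — for such a potential, under CJL-I Theorems 1–2,
  the last clause alone fails: `¬ (ρ differentiable on (0,e⋆) ∧ ρ′ ≤ 16/‖v‖₁ there)`. Argument:
  with `ρ(0⁺) = 0` (Theorem 1) the clause gives `ρ(e) ≤ 16e/‖v‖₁` on `(0,e⋆)`; Theorem 2 gives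
  `e ≤ 2πρ(e)a(1 + O(√ρ(e)))` as `e → 0⁺` (where `ρ(e) → 0`); hence
  `1 ≤ (32πa/‖v‖₁)(1 + o(1))`, impossible when `32πa < ‖v‖₁`.
* `not_CarlenJauslinLieb2021_thm3_derivBound` — hence the printed clause "`ρ ∈ C¹(0,e⋆)` [even:
  differentiable] with `ρ′ ≤ 16/‖v‖₁`" fails for some CJL-II potential, and
  **`not_CarlenJauslinLieb2021_thm3`** — the full printed Theorem 3 (verbatim, all five clauses) is
  false, both under `CarlenJauslinLieb2020_thm1 ∧ CarlenJauslinLieb2020_thm2`.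

Which side is wrong: Theorems 1–2 of CJL-I (existence/uniqueness; the Lee–Huang–Yang leading order
`e ∼ 2πρa`) are the robust ones, and the contradiction enters exactly through the clause
`ρ′ ≤ 16/‖v‖₁` inherited from "(1.21) of [CJL20]"; so it is CJL-II Theorem 3 as printed that is
misstated (history: it was vendored verbatim as the named fact `CarlenJauslinLieb2021_thm3`, found
refuted while attempting its discharge, and retired from the fact list in favour of this file).

## References

* [CarlenJauslinLieb2021] E. A. Carlen, I. Jauslin, E. H. Lieb, *Analysis of a simple equation for
  the ground state of the Bose gas II: monotonicity, convexity, and condensate fraction*, SIAM J.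
  Math. Anal. 53 (2021) 5322–5360, arXiv:2010.13882 (arXiv numbering): Theorem 3 and its proof
  (§3), Lemma 1 and the display following it, Lemmas 18–20, Theorem 8.
* [CarlenJauslinLieb2020] E. A. Carlen, I. Jauslin, E. H. Lieb, *Analysis of a simple equation for
  the ground state energy of the Bose gas*, Pure Appl. Anal. 2 (2020) 659–684, arXiv:1912.04987:
  §1 (the two displays bounding `ρ` in terms of `e`, the second being "(1.21)" in CJL-II's
  citation), Theorem 1, Theorem 2, Lemma 3.1 (`4πa = ∫𝒱(1 − φ)`).
* [Jauslin2022] I. Jauslin, *Review of a simplified approach to study the Bose gas at all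
  densities*, EMS Press (2022), arXiv:2202.07637: Theorem 4.2.
-/

noncomputable section

open MeasureTheory Filter Set Metric
open scoped ENNReal Topology

namespace Literature.MathematicalPhysics.QuantumManyBody

namespace LiebSimpleEquation

open BoseGas (Space)

/-! ## The scattering length of a potential supported in a ball -/

/-- `Y_c` is measurable. [folklore] -/
theorem measurable_yukawa (c : ℝ) : Measurable (yukawa c) := by
  unfold yukawa
  fun_prop

/-- `Y_0 = (4π|x|)⁻¹` is integrable on balls (`|x|⁻¹ ∈ L¹_loc(ℝ³)`, Mathlib
`integrableOn_ball_of_norm_le_rpow`). [folklore] -/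
theorem integrable_indicator_ball_yukawa_zero (R : ℝ) :
    Integrable ((ball (0 : Space) R).indicator (yukawa 0)) := by
  refine (integrableOn_ball_of_norm_le_rpow (E := Space) (μ := volume) ?_ (C := (4 * Real.pi)⁻¹)
    (α := 1) ?_ (Eventually.of_forall fun x => ?_)
    (measurable_yukawa 0).aestronglyMeasurable).integrable_indicator measurableSet_ball
  · rw [finrank_euclideanSpace_fin]; norm_num
  · rw [finrank_euclideanSpace_fin]; norm_num
  · rw [yukawa_zero, Real.norm_of_nonneg (by positivity), Real.rpow_neg_one, mul_inv]

/-- **`a ≤ R` for a bounded non-negative potential supported in `|x| < R`**: for every scattering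
solution `φ` (`0 ≤ φ ≤ 1`, `φ = Y_0 ∗ (v(1 − φ))`) with `v(1 − φ)` integrable,
`∫ v(1 − φ) ≤ 4πR`, i.e. `scatteringLengthOf v φ ≤ R`. Proof: evaluate the scattering equation
at the origin, where `Y_0(y) ≥ (4πR)⁻¹` on the support of `v`, and use `φ(0) ≤ 1`. [folklore] -/
theorem IsScatteringSolution.integral_mul_one_sub_le {v φ : Space → ℝ}
    (hφ : IsScatteringSolution v φ) {R V₀ : ℝ} (hR : 0 < R) (hv0 : ∀ x, 0 ≤ v x)
    (hvb : ∀ x, v x ≤ V₀) (hvR : ∀ x, R ≤ ‖x‖ → v x = 0)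
    (hint : Integrable fun x => v x * (1 - φ x)) :
    ∫ x, v x * (1 - φ x) ≤ 4 * Real.pi * R := by
  set g : Space → ℝ := fun x => v x * (1 - φ x) with hg
  have hV : 0 ≤ V₀ := (hv0 0).trans (hvb 0)
  have hg0 : ∀ x, 0 ≤ g x := fun x => mul_nonneg (hv0 x) (sub_nonneg.2 (hφ.le_one x))
  have hgb : ∀ x, g x ≤ V₀ := fun x => by
    have h1 : 1 - φ x ≤ 1 := by linarith [hφ.nonneg x]
    calc g x = v x * (1 - φ x) := rfl
      _ ≤ V₀ * 1 := mul_le_mul (hvb x) h1 (sub_nonneg.2 (hφ.le_one x)) hV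
      _ = V₀ := mul_one _
  have hgR : ∀ x, R ≤ ‖x‖ → g x = 0 := fun x hx => by simp [hg, hvR x hx]
  -- the scattering equation at the origin
  have h0 : φ 0 = ∫ t, yukawa 0 t * g (0 - t) := by rw [hφ.mild 0, conv_apply]
  set F : Space → ℝ := fun t => yukawa 0 t * g (0 - t) with hF
  have hgi : Integrable fun t => g (0 - t) := hint.comp_sub_left 0
  have hFint : Integrable F := by
    refine ((integrable_indicator_ball_yukawa_zero R).const_mul V₀).mono'
      ((measurable_yukawa 0).aestronglyMeasurable.mul hgi.aestronglyMeasurable)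
      (Eventually.of_forall fun t => ?_)
    rw [Real.norm_of_nonneg (mul_nonneg (yukawa_nonneg 0 t) (hg0 _))]
    by_cases ht : ‖t‖ < R
    · rw [indicator_of_mem (mem_ball_zero_iff.2 ht), mul_comm V₀]
      exact mul_le_mul_of_nonneg_left (hgb _) (yukawa_nonneg 0 t)
    · have h1 : g (0 - t) = 0 := hgR _ (by rw [zero_sub, norm_neg]; exact not_lt.1 ht)
      rw [h1, mul_zero]
      exact mul_nonneg hV (indicator_nonneg (fun x _ => yukawa_nonneg 0 x) t)
  -- a.e. lower bound `(4πR)⁻¹ g(0 - t) ≤ F t` (it may fail only at `t = 0`)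
  have hnull : ∀ᵐ t ∂(volume : Measure Space), t ≠ (0 : Space) := by
    rw [ae_iff]
    simp
  have hae : ∀ᵐ t ∂(volume : Measure Space), (4 * Real.pi * R)⁻¹ * g (0 - t) ≤ F t := by
    filter_upwards [hnull] with t ht
    by_cases htR : ‖t‖ < R
    · have hpos : 0 < ‖t‖ := norm_pos_iff.2 ht
      have hy : (4 * Real.pi * R)⁻¹ ≤ yukawa 0 t := by
        rw [yukawa_zero]
        exact inv_anti₀ (by positivity) (mul_le_mul_of_nonneg_left htR.le (by positivity))
      exact mul_le_mul_of_nonneg_right hy (hg0 _)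
    · have h1 : g (0 - t) = 0 := hgR _ (by rw [zero_sub, norm_neg]; exact not_lt.1 htR)
      show (4 * Real.pi * R)⁻¹ * g (0 - t) ≤ yukawa 0 t * g (0 - t)
      rw [h1, mul_zero, mul_zero]
  have hmono := integral_mono_ae (hgi.const_mul _) hFint hae
  rw [integral_const_mul, integral_sub_left_eq_self g volume (0 : Space)] at hmono
  have hφ0 : φ 0 ≤ 1 := hφ.le_one 0
  have hkey : (4 * Real.pi * R)⁻¹ * ∫ t, g t ≤ 1 := by
    have h2 : ∫ t, F t = φ 0 := h0.symm
    linarith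
  have h4 : 0 < 4 * Real.pi * R := by positivity
  calc ∫ x, g x = (4 * Real.pi * R) * ((4 * Real.pi * R)⁻¹ * ∫ t, g t) := by
        field_simp
    _ ≤ (4 * Real.pi * R) * 1 := by gcongr
    _ = 4 * Real.pi * R := mul_one _

/-- **A CJL-II potential whose scattering length is less than `‖v‖₁/(32π)`**: the square well
`v = 30·𝟙_{|x|<1}` is non-negative, radial, bounded and compactly supported (so
`(1 + |x|⁴)v ∈ L¹ ∩ L²`), `∫v = 40π`, and every scattering solution `φ` of it has
`a = (4π)⁻¹∫v(1 − φ) ≤ 1` (`integral_mul_one_sub_le`; `a = 0` by the junk value if `v(1 − φ)` is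
not integrable), whence `32πa ≤ 32π < 40π = ∫v`. [folklore] -/
theorem exists_isWeightedPotential_scatteringLength_lt :
    ∃ v : Space → ℝ, IsWeightedPotential v ∧ 0 < ∫ x, v x ∧
      ∀ φ, IsScatteringSolution v φ → 32 * Real.pi * scatteringLengthOf v φ < ∫ x, v x := by
  set v : Space → ℝ := (ball (0 : Space) 1).indicator fun _ => (30 : ℝ) with hv
  have hv0 : ∀ x, 0 ≤ v x := fun x => indicator_nonneg (fun _ _ => by norm_num) x
  have hvb : ∀ x, v x ≤ 30 := fun x =>
    indicator_le_self' (fun _ _ => by norm_num) x |>.trans le_rfl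
  have hvR : ∀ x, 1 ≤ ‖x‖ → v x = 0 := fun x hx =>
    indicator_of_notMem (by rwa [mem_ball_zero_iff, not_lt]) _
  have hint : ∫ x, v x = 40 * Real.pi := by
    rw [hv, integral_indicator_const (30 : ℝ) measurableSet_ball, measureReal_def,
      EuclideanSpace.volume_ball_fin_three, ENNReal.toReal_mul, ← ENNReal.ofReal_pow zero_le_one,
      one_pow, ENNReal.toReal_ofReal zero_le_one,
      ENNReal.toReal_ofReal (by positivity : (0 : ℝ) ≤ Real.pi * 4 / 3), smul_eq_mul]
    ring
  have hpos : 0 < ∫ x, v x := by rw [hint]; positivity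
  -- the weighted function `(1 + |x|⁴) v`
  have hw : ∀ x : Space, (1 + ‖x‖ ^ 4) * v x =
      (ball (0 : Space) 1).indicator (fun x => (1 + ‖x‖ ^ 4) * 30) x := by
    intro x
    by_cases hx : x ∈ ball (0 : Space) 1
    · simp [hv, indicator_of_mem hx]
    · simp [hv, indicator_of_notMem hx]
  have hcont : Continuous fun x : Space => (1 + ‖x‖ ^ 4) * (30 : ℝ) := by fun_prop
  have hwint : Integrable fun x : Space => (1 + ‖x‖ ^ 4) * v x := by
    rw [funext hw, integrable_indicator_iff measurableSet_ball]
    exact (hcont.continuousOn.integrableOn_compact (isCompact_closedBall (0 : Space) 1)).mono_set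
      ball_subset_closedBall
  have hwmeas : AEStronglyMeasurable (fun x : Space => (1 + ‖x‖ ^ 4) * v x) volume :=
    hwint.aestronglyMeasurable
  have hwtop : MemLp (fun x : Space => (1 + ‖x‖ ^ 4) * v x) ∞ volume := by
    refine memLp_top_of_bound hwmeas 60 (Eventually.of_forall fun x => ?_)
    rw [hw]
    by_cases hx : x ∈ ball (0 : Space) 1
    · rw [indicator_of_mem hx, Real.norm_of_nonneg (by positivity)]
      have hx1 : ‖x‖ ≤ 1 := (mem_ball_zero_iff.1 hx).le
      have hx4 : ‖x‖ ^ 4 ≤ 1 := pow_le_one₀ (norm_nonneg x) hx1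
      nlinarith
    · rw [indicator_of_notMem hx, norm_zero]; norm_num
  have hw2 : MemLp (fun x : Space => (1 + ‖x‖ ^ 4) * v x) 2 volume := by
    refine hwtop.mono_exponent_of_measure_support_ne_top (s := ball (0 : Space) 1)
      (fun x hx => ?_) measure_ball_lt_top.ne le_top
    rw [hw, indicator_of_notMem hx]
  refine ⟨v, ⟨hv0, fun x y hxy => ?_, hwint, hw2⟩, hpos, fun φ hφ => ?_⟩
  · simp only [hv, indicator, mem_ball_zero_iff, hxy]
  · rw [hint]
    unfold scatteringLengthOf
    by_cases hi : Integrable fun x => v x * (1 - φ x)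
    · have hle := hφ.integral_mul_one_sub_le one_pos hv0 hvb hvR hi
      have hpi : 0 < Real.pi := Real.pi_pos
      calc 32 * Real.pi * ((4 * Real.pi)⁻¹ * ∫ x, v x * (1 - φ x))
          ≤ 32 * Real.pi * ((4 * Real.pi)⁻¹ * (4 * Real.pi * 1)) := by gcongr
        _ = 32 * Real.pi := by field_simp
        _ < 40 * Real.pi := by nlinarith
    · rw [integral_undef hi, mul_zero, mul_zero]
      positivity

/-! ## The inconsistency -/

/-- (Step of the erratum argument.) If `ρ(·)` is continuous on `(0,∞)` with `ρ(0⁺) = 0`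
(CJL-I Theorem 1), differentiable on `(0,E)` with `ρ′ ≤ C` there, `C ≥ 0` (CJL-II Theorem 3,
`C = 16/‖v‖₁`, `E = e⋆`), then `ρ(e) ≤ Ce` on `(0,E)` (mean value inequality on `[ε,e]`,
`ε → 0⁺`). [folklore] -/
theorem densityFn_le_mul_of_deriv_le {v : Space → ℝ} {C E : ℝ}
    (hcont : ContinuousOn (densityFn v) (Ioi 0)) (hzero : Tendsto (densityFn v) (𝓝[>] 0) (𝓝 0))
    (hdiff : DifferentiableOn ℝ (densityFn v) (Ioo 0 E))
    (hderiv : ∀ e ∈ Ioo 0 E, deriv (densityFn v) e ≤ C) (hC : 0 ≤ C) {e : ℝ}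
    (he : e ∈ Ioo 0 E) : densityFn v e ≤ C * e := by
  have hmvt : ∀ ε ∈ Ioo 0 e, densityFn v e - densityFn v ε ≤ C * (e - ε) := by
    intro ε hε
    have hc' : ContinuousOn (densityFn v) (Ioo 0 E) := hcont.mono Ioo_subset_Ioi_self
    have hd' : DifferentiableOn ℝ (densityFn v) (interior (Ioo 0 E)) := by rwa [interior_Ioo]
    have hle : ∀ x ∈ interior (Ioo 0 E), deriv (densityFn v) x ≤ C := by
      rw [interior_Ioo]; exact hderiv
    exact (convex_Ioo 0 E).image_sub_le_mul_sub_of_deriv_le hc' hd' hle ε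
      ⟨hε.1, hε.2.trans he.2⟩ e he hε.2.le
  have hev : ∀ᶠ ε in 𝓝[>] (0 : ℝ), densityFn v e - C * e ≤ densityFn v ε := by
    filter_upwards [Ioo_mem_nhdsGT he.1] with ε hε
    have h1 := hmvt ε hε
    have h2 : 0 ≤ C * ε := mul_nonneg hC hε.1.le
    linarith
  have hlim := le_of_tendsto_of_tendsto tendsto_const_nhds hzero hev
  linarith

/-- **The printed bound `ρ′ ≤ 16/‖v‖₁` on `(0,e⋆)` is inconsistent with CJL-I Theorems 1–2 for
strong potentials.** If a CJL-II potential `v` (`IsWeightedPotential`, `v ≢ 0`) has `32π·a < ‖v‖₁`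
for every scattering solution (e.g. the square well of
`exists_isWeightedPotential_scatteringLength_lt`), then, under `CarlenJauslinLieb2020_thm1` and
`CarlenJauslinLieb2020_thm2`, it is false that `ρ(·) = densityFn v` is differentiable on
`(0,e⋆)`, `e⋆ = √2π³/‖v‖₁²`, with `ρ′ ≤ 16/‖v‖₁` there (the last clause of CJL-II Theorem 3 as
printed, which asserts even `C¹`). Argument: Theorem 1 gives `ρ(0⁺) = 0`, hence
`ρ(e) ≤ 16e/‖v‖₁` on `(0,e⋆)`; Theorem 2 gives `e ≤ 2πρ(e)a(1 + O(√ρ(e)))` along `e → 0⁺`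
(where `ρ(e) → 0`), so `1 ≤ (32πa/‖v‖₁)(1 + o(1))`, contradicting `32πa < ‖v‖₁`. The defect in
print: the proof of Theorem 3 uses the upper bound `ρ ≤ 4e/‖v‖₁` ("(1.21) of [CJL20]"), which
does not follow from the display preceding it in CJL-I §1 and fails at low energy whenever
`a < ‖v‖₁/(8π)` (see the module docstring).
[cite: CarlenJauslinLieb2021, Theorem 3 and its proof (§3); CarlenJauslinLieb2020, §1 and Theorems 1–2] -/
theorem not_CarlenJauslinLieb2021_thm3_of_potential {v : Space → ℝ} (hv : IsWeightedPotential v)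
    (hpos : 0 < ∫ x, v x)
    (hsmall : ∀ φ, IsScatteringSolution v φ → 32 * Real.pi * scatteringLengthOf v φ < ∫ x, v x)
    (h1 : CarlenJauslinLieb2020_thm1) (h2 : CarlenJauslinLieb2020_thm2) :
    ¬ (DifferentiableOn ℝ (densityFn v) (Ioo 0 (eStar v)) ∧
        ∀ e ∈ Ioo 0 (eStar v), deriv (densityFn v) e ≤ 16 / ∫ x, v x) := by
  rintro ⟨hC1, hder⟩
  have hp : (3 : ℝ≥0∞) / 2 < 2 := three_halves_lt_two
  have hv2 : MemLp v 2 := hv.memLp_two_self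
  have hvi : Integrable v := hv.integrable_self
  obtain ⟨hcont, hzero, -⟩ := continuousOn_densityFn h1 hp hv.nonneg hvi hv2 hpos
  obtain ⟨-, ⟨φ, hφ, hasym⟩, -⟩ := h2 v hv.nonneg hvi hv2 hpos
  set I : ℝ := ∫ x, v x with hI
  set a : ℝ := scatteringLengthOf v φ with ha
  set C : ℝ := 16 / I with hC
  set c : ℝ := 128 / (15 * Real.sqrt Real.pi) with hc
  have hc0 : 0 ≤ c := by positivity
  have hC0 : 0 ≤ C := by positivity
  have hq : 32 * Real.pi * a < I := hsmall φ hφ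
  -- ρ(e) ≤ C e on (0, e⋆)
  have hρle : ∀ e ∈ Ioo 0 (eStar v), densityFn v e ≤ C * e := fun e he =>
    densityFn_le_mul_of_deriv_le hcont hzero hC1 hder hC0 he
  -- solutions along the density function, positivity of ρ(e)
  have hsol : ∀ e, 0 < e → ∃ u, IsSolution v (densityFn v e) e u := fun e he =>
    (existsUnique_isSolution_densityFn h1 hp hv.nonneg hvi hv2 hpos he).exists
  have hρpos : ∀ e, 0 < e → 0 < densityFn v e := by
    intro e he
    obtain ⟨u, hu⟩ := hsol e he
    by_contra hle
    have hle' : densityFn v e ≤ 0 := not_lt.1 hle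
    have hE : e = densityFn v e / 2 * ∫ x, (1 - u x) * v x := hu.energy
    have hnn : 0 ≤ ∫ x, (1 - u x) * v x :=
      integral_nonneg fun x => mul_nonneg (sub_nonneg.2 (hu.le_one x)) (hv.nonneg x)
    nlinarith
  -- the one-sided consequence of Theorem 2 (ε = 1): e ≤ 2πρa(1 + √ρ (c√(a³) + 1))
  obtain ⟨ρ₀, hρ₀, hA⟩ := hasym 1 one_pos
  have hupper : ∀ e, 0 < e → densityFn v e < ρ₀ →
      e ≤ 2 * Real.pi * densityFn v e * a *
        (1 + Real.sqrt (densityFn v e) * (c * Real.sqrt (a ^ 3) + 1)) := by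
    intro e he hlt
    obtain ⟨u, hu⟩ := hsol e he
    have hρ := hρpos e he
    have hab := (abs_le.1 (hA _ e u hρ hlt he hu)).2
    rw [Real.sqrt_mul hρ.le] at hab
    have : 2 * Real.pi * densityFn v e * a *
        (1 + Real.sqrt (densityFn v e) * (c * Real.sqrt (a ^ 3) + 1)) =
        2 * Real.pi * densityFn v e * a *
          (1 + 128 / (15 * Real.sqrt Real.pi) * (Real.sqrt (densityFn v e) * Real.sqrt (a ^ 3))) +
        1 * (2 * Real.pi * densityFn v e * a) * Real.sqrt (densityFn v e) := by
      rw [hc]; ring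
    rw [this]
    linarith
  -- small energies with small density exist
  have hsmallE : ∀ η, 0 < η → ∃ e, e ∈ Ioo 0 (eStar v) ∧ densityFn v e < η := by
    intro η hη
    have h1' : ∀ᶠ e in 𝓝[>] (0 : ℝ), densityFn v e < η := hzero.eventually (gt_mem_nhds hη)
    have h2' : ∀ᶠ e in 𝓝[>] (0 : ℝ), e ∈ Ioo 0 (eStar v) := Ioo_mem_nhdsGT (eStar_pos hpos)
    obtain ⟨e, he1, he2⟩ := (h1'.and h2').exists
    exact ⟨e, he2, he1⟩
  -- Step 1: a > 0
  have ha0 : 0 < a := by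
    obtain ⟨e, he, hlt⟩ := hsmallE ρ₀ hρ₀
    have hρ := hρpos e he.1
    have hup := hupper e he.1 hlt
    by_contra hle
    have hle' : a ≤ 0 := not_lt.1 hle
    have hS : 0 ≤ Real.sqrt (densityFn v e) * (c * Real.sqrt (a ^ 3) + 1) := by positivity
    have hX : 2 * Real.pi * densityFn v e * a ≤ 0 := by
      have : 0 ≤ 2 * Real.pi * densityFn v e := by positivity
      exact mul_nonpos_iff.2 (Or.inl ⟨this, hle'⟩)
    nlinarith [he.1]
  -- Step 2: the contradiction at a small enough energy
  set s : ℝ := 32 * Real.pi * a / I with hs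
  have hI0 : 0 < I := hpos
  have hs0 : 0 < s := by positivity
  have hs1 : s < 1 := by rw [hs, div_lt_one hI0]; exact hq
  set M : ℝ := c * Real.sqrt (a ^ 3) + 1 with hM
  have hM0 : 0 < M := by positivity
  set δ : ℝ := (1 - s) / (2 * s) with hδ
  have hδ0 : 0 < δ := by rw [hδ]; exact div_pos (by linarith) (by positivity)
  set η : ℝ := (δ / M) ^ 2 with hη
  have hη0 : 0 < η := by positivity
  obtain ⟨e, he, hlt⟩ := hsmallE (min ρ₀ η) (lt_min hρ₀ hη0)
  have hρ := hρpos e he.1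
  have hup := hupper e he.1 (hlt.trans_le (min_le_left _ _))
  have hρC := hρle e he
  -- √ρ M < δ
  have hsq : Real.sqrt (densityFn v e) * M < δ := by
    have h1' : Real.sqrt (densityFn v e) < Real.sqrt η :=
      Real.sqrt_lt_sqrt hρ.le (hlt.trans_le (min_le_right _ _))
    have h2' : Real.sqrt η = δ / M := by rw [hη, Real.sqrt_sq (by positivity)]
    rw [h2'] at h1'
    calc Real.sqrt (densityFn v e) * M < δ / M * M := by gcongr
      _ = δ := by field_simp
  -- e ≤ 2π a (1 + √ρ M) ρ ≤ 2π a (1 + √ρ M) C e, hence 1 ≤ s (1 + √ρ M) < s (1 + δ) < 1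
  have hT : 0 ≤ Real.sqrt (densityFn v e) * M := by positivity
  have h_one : 1 ≤ s * (1 + Real.sqrt (densityFn v e) * M) := by
    have hfac : 0 ≤ 2 * Real.pi * a * (1 + Real.sqrt (densityFn v e) * M) := by positivity
    have h3' : e ≤ 2 * Real.pi * a * (1 + Real.sqrt (densityFn v e) * M) * (C * e) := by
      calc e ≤ 2 * Real.pi * densityFn v e * a * (1 + Real.sqrt (densityFn v e) * M) := hup
        _ = 2 * Real.pi * a * (1 + Real.sqrt (densityFn v e) * M) * densityFn v e := by ring
        _ ≤ 2 * Real.pi * a * (1 + Real.sqrt (densityFn v e) * M) * (C * e) := by gcongr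
    have h4' : 2 * Real.pi * a * (1 + Real.sqrt (densityFn v e) * M) * (C * e) =
        (s * (1 + Real.sqrt (densityFn v e) * M)) * e := by
      rw [hs, hC]; field_simp; ring
    rw [h4'] at h3'
    by_contra hlt'
    have hlt'' : s * (1 + Real.sqrt (densityFn v e) * M) < 1 := not_le.1 hlt'
    have : s * (1 + Real.sqrt (densityFn v e) * M) * e < 1 * e := by gcongr; exact he.1
    linarith
  have h_two : s * (1 + Real.sqrt (densityFn v e) * M) < 1 := by
    calc s * (1 + Real.sqrt (densityFn v e) * M) < s * (1 + δ) := by gcongr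
      _ = (1 + s) / 2 := by rw [hδ]; field_simp; ring
      _ < 1 := by linarith
  linarith

/-- **The last clause of CJL-II Theorem 3 as printed is false** (under CJL-I Theorems 1–2): it is
not the case that for every CJL-II potential `v ≢ 0` the density function `ρ(·) = densityFn v` is
differentiable on `(0,e⋆)`, `e⋆ = √2π³/‖v‖₁²`, with `ρ′ ≤ 16/‖v‖₁` there (printed: "for `e < e⋆`
… `ρ(e)` is continuously differentiable … Moreover, for `e < e⋆` we have `ρ′ ≤ 16/‖v‖₁`") —
witnessed by the square well `v = 30·𝟙_{|x|<1}` (`exists_isWeightedPotential_scatteringLength_lt`,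
`not_CarlenJauslinLieb2021_thm3_of_potential`).
[cite: CarlenJauslinLieb2021, Theorem 3; CarlenJauslinLieb2020, §1 and Theorems 1–2] -/
theorem not_CarlenJauslinLieb2021_thm3_derivBound (h1 : CarlenJauslinLieb2020_thm1)
    (h2 : CarlenJauslinLieb2020_thm2) :
    ¬ ∀ v : Space → ℝ, IsWeightedPotential v → 0 < ∫ x, v x →
        DifferentiableOn ℝ (densityFn v) (Ioo 0 (eStar v)) ∧
          ∀ e ∈ Ioo 0 (eStar v), deriv (densityFn v) e ≤ 16 / ∫ x, v x := by
  intro h3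
  obtain ⟨v, hv, hpos, hsmall⟩ := exists_isWeightedPotential_scatteringLength_lt
  exact not_CarlenJauslinLieb2021_thm3_of_potential hv hpos hsmall h1 h2 (h3 v hv hpos)

/-- **CJL-II Theorem 3 as printed is inconsistent with CJL-I Theorems 1–2.** The printed theorem —
"Assume that `(1 + |x|⁴)v ∈ L¹(ℝ³) ∩ L²(ℝ³)`. For `e < e⋆ := √2π³/‖v‖₁²` and for
`e > 2³‖v‖₂⁴/π⁴`, `ρ(e)` is strictly monotone increasing in `e`, and in these intervals `ρ(e)` is
continuously differentiable. […] Moreover, for `e < e⋆` we have `ρ′ = dρ/de ≤ 16/‖v‖₁`" — rendered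
verbatim below (with `ρ(·) = densityFn v` (CJL-I Theorem 1), `e > 0` throughout, the tacit `v ≢ 0`
explicit, `e⋆ = eStar v`, `2³‖v‖₂⁴/π⁴ = eHigh v`; the `L²`-differentiability of `e ↦ u(e,·)` not
recorded), is false given the named facts `CarlenJauslinLieb2020_thm1`,
`CarlenJauslinLieb2020_thm2`: already its last clause fails for the square well `v = 30·𝟙_{|x|<1}`
(`not_CarlenJauslinLieb2021_thm3_derivBound`). This is why Theorem 3 is not vendored as a named
fact; see the module docstring for the located defect (the upper half of "(1.21) of [CJL20]" used
in the proof of Theorem 3) and for what the printed argument still supports.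
[cite: CarlenJauslinLieb2021, Theorem 3; CarlenJauslinLieb2020, §1 and Theorems 1–2] -/
theorem not_CarlenJauslinLieb2021_thm3 (h1 : CarlenJauslinLieb2020_thm1)
    (h2 : CarlenJauslinLieb2020_thm2) :
    ¬ ∀ v : Space → ℝ, IsWeightedPotential v → 0 < ∫ x, v x →
        StrictMonoOn (densityFn v) (Ioo 0 (eStar v)) ∧
        StrictMonoOn (densityFn v) (Ioi (max 0 (eHigh v))) ∧
        ContDiffOn ℝ 1 (densityFn v) (Ioo 0 (eStar v)) ∧
        ContDiffOn ℝ 1 (densityFn v) (Ioi (max 0 (eHigh v))) ∧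
        ∀ e ∈ Ioo 0 (eStar v), deriv (densityFn v) e ≤ 16 / ∫ x, v x := by
  intro h3
  refine not_CarlenJauslinLieb2021_thm3_derivBound h1 h2 fun v hv hpos => ?_
  obtain ⟨-, -, hC1, -, hder⟩ := h3 v hv hpos
  exact ⟨hC1.differentiableOn one_ne_zero, hder⟩

end LiebSimpleEquation

end Literature.MathematicalPhysics.QuantumManyBody

end
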